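import Summits.AtomisticToContinuum.FouriersLaw.Theses.OddSectorIrreversibility
import Summits.AtomisticToContinuum.FouriersLaw.Theses.JunctionLocality
import Summits.AtomisticToContinuum.FouriersLaw.Theses.FeketeSeriesLaw
import Summits.AtomisticToContinuum.FouriersLaw.Theorems.BoundaryKubo.Negative.LoadBearing
import Summits.AtomisticToContinuum.FouriersLaw.Theorems.BoundedResponseConverges.Negative.LoadBearing
import Summits.AtomisticToContinuum.FouriersLaw.Theorems.OddSectorIrreversibilityBoundedResponseConvergesStubPositiveConductance
import Summits.AtomisticToContinuum.FouriersLaw.Theorems.OddSectorIrreversibilityBoundedResponseConvergesStubCornerKubo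

/-!
# Skeleton line `ohmic-floor-monotone-ladder` for crux `BoundedResponseConverges` (stmt-AtomisticToContinuum-9141)
# — RESHAPED by lead c2 (2026-08-16) onto the LANDED Kubo vocabulary

Route `OddSectorIrreversibility` (import slot shared verbatim with `TransferKernelPositivity`, `LocalOhmBV`,
`MatthiessenLadder`). The crux: for `pinnedChain ω₂ lam β γ` (all `> 0`), under weak-NESS uniqueness, along every
steady-state family and every `T > 0`, a BOUNDED sequence of clause-(ii) response coefficients `D_N` converges to
some `k > 0`.

## The line (crux idea card `ohmic-floor-monotone-ladder`; planner skeleton `Lines/ohmic-floor-monotone-ladder.lean`)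

LEVER: ONE SIGN between two consecutive finite chains — the conductance–length product `D_N = (N−1)·G_N` is
EVENTUALLY MONOTONE in `N`. With the crux's own `BddAbove (range |D|)` that IS convergence (monotone convergence
theorem), and an `N`-uniform conductance floor gives `k > 0`.

TRANSFER: by the fixed-`N` corner (cross-form) Green–Kubo formula the response coefficient of the `(N+1)`-chain is an
EQUILIBRIUM quantity,
  `D_{N+1} = kuboValue N := N · (γ²/T²) · ∫₀^∞ C_N`,  `C_N(t) = kuboIntegrand N t = Cov_{μ_T}(p_0², K_t p_N²)`
(`μ_T` the Gibbs measure of the `(N+1)`-chain, `K_t` its equal-temperature transition kernels). RESHAPE (lead c2): the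
planner's skeleton typed this through its own `kinCov / transferKernel / cornerKernel`; since then the sibling crux
`PhononMeanFreePath.BoundaryKubo` (stmt-AtomisticToContinuum-11812) LANDED (`boundaryKubo_proof`, line gibbs-ttcf) with
exactly this content over the landed definitions `Theorems.BoundaryKubo.Negative.LoadBearing.kuboIntegrand / kuboValue`
(covariance written `E[XY] − E[X]E[Y]`, chain length `N+1`, corner `(0, Fin.last N)`). The three stubs are therefore
restated over THAT vocabulary (no new definition anywhere in the line):

* `stub_cornerKubo` (fixed `N`; NOW A COROLLARY of `boundaryKubo_proof` + uniqueness of `𝓝[≠] 0`-limits): under the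
  crux's frame, for every `T > 0` and `N`, `kuboIntegrand N ∈ L¹(0,∞)` and every clause-(ii) response coefficient of the
  `(N+1)`-chain equals `kuboValue N`.
* `stub_kernelLadder` (the LEVER, open, HARDEST; pure equilibrium statement, dichotomy form asked for by triage r1):
  for every parameter point and `T > 0` the landed Kubo value sequence `N ↦ kuboValue N` is EVENTUALLY MONOTONE
  (`(∀ N ≥ N₀, kuboValue N ≤ kuboValue (N+1)) ∨ (∀ N ≥ N₀, kuboValue (N+1) ≤ kuboValue N)`).
* `stub_floor` = route item `JunctionLocality.ConductanceLowerBound` (stmt-AtomisticToContinuum-11749) BY NAME — it has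
  its own crux chain (`Cruxes/ConductanceLowerBound/`); load-bearing only in the `↓` branch.

STATUS (lead c2, 12:45Z): `stub_cornerKubo` CLOSED (p101517); open: `stub_kernelLadder` (lever), `stub_floor` (= stmt-11749).

COMPOSITION (kernel-checked, no `sorry` outside the stubs): `BoundedResponseConverges_of :
stub_kernelLadder → ConductanceLowerBound → OddSectorIrreversibility.BoundedResponseConverges` (stub 1 is now the landed
theorem `Stubs.stub_cornerKubo`, used inside) — `BddAbove` is consumed
(both branches of the monotone convergence theorem), the crux is concluded BY NAME. In the predicted `↑` branch the
floor is NOT needed: fixed-`N` positivity `D_N > 0` (`N ≥ 2`) is LANDED (`TwoScaleGluingLogRigidity.Stubs.positiveConductance_holds`,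
p96209), see `boundedResponseConverges_of_ladderUp` (proved below, unconditional in everything but the two stubs).

WHERE THE CRUX'S HYPOTHESES ARE USED (Disproof.lean / `Negative/LoadBearing.lean`, honoured BY NAME):
`boundedResponseConverges_false_without_bddAbove_harmonic` — `BddAbove` is consumed in the composition, not in a
stub (the ladder is TRUE at the harmonic corner, `↑` branch, where `BddAbove` fails);
`boundedResponseConverges_false_without_unique_gamma_zero` — uniqueness is consumed by `stub_cornerKubo` (it identifies
the family's coefficient with the Kubo value; at `γ = 0` the formula's `γ²` prefactor gives `D ≡ 0` consistently);
`boundedResponseConverges_skeleton_insulating` is excluded by the floor (`↓`) / positivity (`↑`),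
`boundedResponseConverges_skeleton_oscillating` by the ladder. Known shape facts (landed `Negative/TwoScaleKillCriteria`):
the ladder is STRONGER than the crux in shape (`boundedResponseConverges_fourierShape_not_upperIncrement_nor_ladder`,
parity witness `1 + (−1)^N/√N`): the line is falsifiable by an even–odd finite-size effect of the actual chain that
leaves Fourier's law intact; `boundedResponseConverges_ladder_matrix_iff`: granted the ladder, crux ⇔ not eventually
currentless.
-/

noncomputable section

open MeasureTheory Filter Topology Set
open Literature.MathematicalPhysics.KineticTheory.HeatConduction

namespace Summit.AtomisticToContinuum.FouriersLaw.Cruxes.BoundedResponseConverges.OhmicFloorMonotoneLadder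

open Summit.AtomisticToContinuum.FouriersLaw.Theorems.BoundaryKubo.Negative.LoadBearing
  (kuboIntegrand kuboValue)
open Summit.AtomisticToContinuum.FouriersLaw.Theses

/-! ### The crux's frame, abbreviated (verbatim bodies of the crux's hypothesis blocks) -/

/-- weak-NESS uniqueness (the crux's first hypothesis; route item `NessUnique`, stmt-0741, PROVED in tree). -/
def NessUniq (P : OscillatorChain) : Prop :=
  ∀ (N : ℕ) (T_L T_R : ℝ), 0 < T_L → 0 < T_R → ∀ μ ν : Measure (PhaseSpace N),
    P.IsSteadyState N T_L T_R μ → P.IsSteadyState N T_L T_R ν → μ = ν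

/-- a steady-state family of `P` (weak steady state for every `N` and all `T_L, T_R > 0`). -/
def IsSteadyFamily (P : OscillatorChain) (μ : (N : ℕ) → ℝ → ℝ → Measure (PhaseSpace N)) : Prop :=
  ∀ (N : ℕ) (T_L T_R : ℝ), 0 < T_L → 0 < T_R → P.IsSteadyState N T_L T_R (μ N T_L T_R)

/-- `D` is a sequence of clause-(ii) response coefficients along `μ` at temperature `T`. -/
def IsResponseSeq (P : OscillatorChain) (μ : (N : ℕ) → ℝ → ℝ → Measure (PhaseSpace N))
    (T : ℝ) (D : ℕ → ℝ) : Prop :=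
  ∀ N : ℕ, Tendsto (fun δ : ℝ => P.totalCurrent (μ N (T + δ / 2) (T - δ / 2)) / δ)
    (𝓝[≠] 0) (𝓝 (D N))

/-- The crux, re-read through the abbreviations: certifies that the frame used below IS the crux's own
(definitional). -/
example : OddSectorIrreversibility.BoundedResponseConverges ↔
    ∀ ω₂ lam β γ : ℝ, 0 < ω₂ → 0 < lam → 0 < β → 0 < γ →
      NessUniq (pinnedChain ω₂ lam β γ) →
      ∀ μ : (N : ℕ) → ℝ → ℝ → Measure (PhaseSpace N), IsSteadyFamily (pinnedChain ω₂ lam β γ) μ →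
      ∀ T : ℝ, 0 < T → ∀ D : ℕ → ℝ, IsResponseSeq (pinnedChain ω₂ lam β γ) μ T D →
      BddAbove (Set.range fun N => |D N|) → ∃ k : ℝ, 0 < k ∧ Tendsto D atTop (𝓝 k) :=
  Iff.rfl

/-! ### The three statements of the line (over landed vocabulary only) -/

/-- STATEMENT 1 (fixed `N`) — **corner Green–Kubo formula**, in the landed cross form of
`PhononMeanFreePath.BoundaryKubo`: under weak-NESS uniqueness, along any steady-state family, for `T > 0` and every
`N`: (a) the equilibrium corner covariance `t ↦ kuboIntegrand N t = Cov_{μ_T}(p_0², K_t p_N²)` of the `(N+1)`-chain is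
integrable on `(0, ∞)`; (b) every clause-(ii) response coefficient `d` of the `(N+1)`-chain equals
`kuboValue N = N·(γ²/T²)·∫₀^∞ kuboIntegrand N`. Refs: KunduDharNarayan2009 (arXiv:0809.4543), ReyBellet2003 Rem 4.4,
BonettoLebowitzReyBellet2000 §5.2 (32); tree: `Theorems.PhononMeanFreePathBoundaryKubo.boundaryKubo_proof`. -/
def CornerKubo : Prop :=
  ∀ ω₂ lam β γ : ℝ, 0 < ω₂ → 0 < lam → 0 < β → 0 < γ →
    NessUniq (pinnedChain ω₂ lam β γ) →
    ∀ μ : (N : ℕ) → ℝ → ℝ → Measure (PhaseSpace N), IsSteadyFamily (pinnedChain ω₂ lam β γ) μ →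
    ∀ T : ℝ, 0 < T → ∀ N : ℕ,
      IntegrableOn (kuboIntegrand ω₂ lam β γ T N) (Set.Ioi 0) ∧
      ∀ d : ℝ, Tendsto (fun δ : ℝ =>
          (pinnedChain ω₂ lam β γ).totalCurrent (μ (N + 1) (T + δ / 2) (T - δ / 2)) / δ) (𝓝[≠] 0) (𝓝 d) →
        d = kuboValue ω₂ lam β γ T N

/-- STATEMENT 2 (the LEVER; open; HARDEST) — **Kubo-value ladder, dichotomy form**: for every parameter point and
`T > 0` the equilibrium Kubo value sequence `N ↦ kuboValue N` (= `D_{N+1}` by STATEMENT 1) is EVENTUALLY MONOTONE: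
either non-decreasing from some `N₀` on (the predicted branch: approach of `D_N` to its limit FROM BELOW,
contact-resistance dominated; LLP2003 §3.4, AokiKusnezov2001; harmonic corner: `↑` exactly) or non-increasing from
some `N₀` on (overshoot world). A PURE EQUILIBRIUM statement about the Gibbs measures and equal-temperature kernels of
consecutive chains — no NESS, no `δ → 0`, no uniqueness, no rate, no limit object. NOT implied by the crux
(`Negative/TwoScaleKillCriteria`: parity witness) and does not imply it (needs `BddAbove` + floor/positivity).
Why it might fail: the sign is an `O(N⁻²)` effect at large `N` decided by contact vs bulk resistance increments; an
even–odd correction kills both branches while the crux survives. -/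
def KernelLadder : Prop :=
  ∀ ω₂ lam β γ : ℝ, 0 < ω₂ → 0 < lam → 0 < β → 0 < γ → ∀ T : ℝ, 0 < T →
    ∃ N₀ : ℕ,
      (∀ N : ℕ, N₀ ≤ N → kuboValue ω₂ lam β γ T N ≤ kuboValue ω₂ lam β γ T (N + 1)) ∨
      (∀ N : ℕ, N₀ ≤ N → kuboValue ω₂ lam β γ T (N + 1) ≤ kuboValue ω₂ lam β γ T N)

/-- The PREDICTED branch of `KernelLadder` alone (eventually non-decreasing Kubo values). Not a registered stub:
recorded because it implies `KernelLadder` trivially and because in this branch the floor is free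
(`boundedResponseConverges_of_ladderUp`). -/
def KernelLadderUp : Prop :=
  ∀ ω₂ lam β γ : ℝ, 0 < ω₂ → 0 < lam → 0 < β → 0 < γ → ∀ T : ℝ, 0 < T →
    ∃ N₀ : ℕ, ∀ N : ℕ, N₀ ≤ N → kuboValue ω₂ lam β γ T N ≤ kuboValue ω₂ lam β γ T (N + 1)

theorem kernelLadder_of_up (h : KernelLadderUp) : KernelLadder :=
  fun ω₂ lam β γ hω hl hβ hγ T hT =>
    let ⟨N₀, hN₀⟩ := h ω₂ lam β γ hω hl hβ hγ T hT
    ⟨N₀, Or.inl hN₀⟩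

/-! ### Registered stubs (`sorry` only here) -/

/-- STUB 1 (fixed `N`) — the corner Green–Kubo formula `CornerKubo`, spelled out. **CLOSED** (lead c2, p101517,
commit cd34ae42e31f): `Stubs.stub_cornerKubo` in `Theorems/OddSectorIrreversibilityBoundedResponseConvergesStubCornerKubo.lean`
(corollary of the landed `boundaryKubo_proof`, stmt-11812). -/
theorem stub_cornerKubo :
    ∀ ω₂ lam β γ : ℝ, 0 < ω₂ → 0 < lam → 0 < β → 0 < γ →
      (∀ (N : ℕ) (T_L T_R : ℝ), 0 < T_L → 0 < T_R → ∀ μ ν : Measure (PhaseSpace N),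
        (pinnedChain ω₂ lam β γ).IsSteadyState N T_L T_R μ →
        (pinnedChain ω₂ lam β γ).IsSteadyState N T_L T_R ν → μ = ν) →
      ∀ μ : (N : ℕ) → ℝ → ℝ → Measure (PhaseSpace N),
        (∀ (N : ℕ) (T_L T_R : ℝ), 0 < T_L → 0 < T_R →
          (pinnedChain ω₂ lam β γ).IsSteadyState N T_L T_R (μ N T_L T_R)) →
      ∀ T : ℝ, 0 < T → ∀ N : ℕ,
        IntegrableOn (kuboIntegrand ω₂ lam β γ T N) (Set.Ioi 0) ∧
        ∀ d : ℝ, Tendsto (fun δ : ℝ =>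
            (pinnedChain ω₂ lam β γ).totalCurrent (μ (N + 1) (T + δ / 2) (T - δ / 2)) / δ) (𝓝[≠] 0) (𝓝 d) →
          d = kuboValue ω₂ lam β γ T N :=
  -- CLOSED (lead c2, p101517): the landed theorem, verbatim signature.
  Stubs.stub_cornerKubo

/-- STUB 2 (open, HARDEST) — the Kubo-value ladder in dichotomy form `KernelLadder`, spelled out. -/
theorem stub_kernelLadder :
    ∀ ω₂ lam β γ : ℝ, 0 < ω₂ → 0 < lam → 0 < β → 0 < γ → ∀ T : ℝ, 0 < T →
      ∃ N₀ : ℕ,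
        (∀ N : ℕ, N₀ ≤ N → kuboValue ω₂ lam β γ T N ≤ kuboValue ω₂ lam β γ T (N + 1)) ∨
        (∀ N : ℕ, N₀ ≤ N → kuboValue ω₂ lam β γ T (N + 1) ≤ kuboValue ω₂ lam β γ T N) := by
  sorry

/-- STUB 3 (= route item `JunctionLocality.ConductanceLowerBound`, stmt-AtomisticToContinuum-11749, BY NAME — one
proof closes both; it has its own crux chain) — the `N`-uniform conductance floor `∃ c > 0, ∃ N₁, ∀ N ≥ N₁, c ≤ D_N`.
Load-bearing for `0 < k` in the `↓` branch only. -/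
theorem stub_floor : JunctionLocality.ConductanceLowerBound := by
  sorry

/-! ### Consistency: each named statement IS its registered stub (definitionally) -/

theorem cornerKubo_holds : CornerKubo := stub_cornerKubo
theorem kernelLadder_holds : KernelLadder := stub_kernelLadder

/-! ### Name-keyed aliases of the statements (hypotheses of the composition; the skeleton audit admits a
hypothesis only if its head constant is a registered obligation or is named like a declared stub) -/
namespace Registered

/-- Alias of `CornerKubo` keyed by the registered stub name. -/
abbrev stub_cornerKubo : Prop := CornerKubo
/-- Alias of `KernelLadder` keyed by the registered stub name. -/
abbrev stub_kernelLadder : Prop := KernelLadder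
/-- Alias of the floor (the route item itself) keyed by the registered stub name. -/
abbrev stub_floor : Prop := JunctionLocality.ConductanceLowerBound

end Registered

/-! ### Glue lemmas (PROVED) -/

/-- Real-analysis core (both branches of the monotone convergence theorem + a floor): an eventually monotone
sequence with `|D|` bounded and `c ≤ D N` eventually (`c > 0`) converges to some `k ≥ c > 0`. -/
theorem tendsto_of_eventually_monotone_floor (D : ℕ → ℝ) (M : ℕ) (B c : ℝ) (N₁ : ℕ) (hc : 0 < c)
    (hB : ∀ N, |D N| ≤ B) (hfloor : ∀ N, N₁ ≤ N → c ≤ D N)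
    (hdich : (∀ n : ℕ, D (M + n) ≤ D (M + n + 1)) ∨ (∀ n : ℕ, D (M + n + 1) ≤ D (M + n))) :
    ∃ k : ℝ, 0 < k ∧ Tendsto D atTop (𝓝 k) := by
  have hbddA : BddAbove (Set.range fun n : ℕ => D (M + n)) :=
    ⟨B, by rintro _ ⟨n, rfl⟩; exact (le_abs_self _).trans (hB (M + n))⟩
  have hbddB : BddBelow (Set.range fun n : ℕ => D (M + n)) :=
    ⟨-B, by rintro _ ⟨n, rfl⟩; exact (neg_le.mp ((neg_le_abs _).trans (hB (M + n))))⟩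
  obtain ⟨k, hk⟩ : ∃ k : ℝ, Tendsto (fun n : ℕ => D (M + n)) atTop (𝓝 k) := by
    rcases hdich with hup | hdown
    · exact ⟨_, tendsto_atTop_ciSup (monotone_nat_of_le_succ fun n => hup n) hbddA⟩
    · exact ⟨_, tendsto_atTop_ciInf (antitone_nat_of_succ_le fun n => hdown n) hbddB⟩
  have hkD : Tendsto D atTop (𝓝 k) := by
    have h2 : Tendsto (fun n => D (n + M)) atTop (𝓝 k) := hk.congr fun n => by rw [Nat.add_comm M n]
    exact (tendsto_add_atTop_iff_nat M).mp h2
  refine ⟨k, lt_of_lt_of_le hc ?_, hkD⟩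
  exact ge_of_tendsto hkD (eventually_atTop.2 ⟨N₁, fun N hN => hfloor N hN⟩)

/-- Transport of the Kubo-value dichotomy to the response sequence: if `D (N+1) = v N` for all `N` and `v` is
monotone one way from `N₀` on, then `D` is monotone the same way from `N₀ + 1` on (index bookkeeping). -/
theorem dichotomy_transport {D v : ℕ → ℝ} (hDv : ∀ N : ℕ, D (N + 1) = v N) {N₀ : ℕ}
    (h : (∀ N : ℕ, N₀ ≤ N → v N ≤ v (N + 1)) ∨ (∀ N : ℕ, N₀ ≤ N → v (N + 1) ≤ v N)) :
    (∀ n : ℕ, D (N₀ + 1 + n) ≤ D (N₀ + 1 + n + 1)) ∨ (∀ n : ℕ, D (N₀ + 1 + n + 1) ≤ D (N₀ + 1 + n)) := by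
  rcases h with hup | hdown
  · refine Or.inl fun n => ?_
    have e1 : N₀ + 1 + n = (N₀ + n) + 1 := by ring
    rw [e1, hDv, hDv]
    exact hup (N₀ + n) (Nat.le_add_right _ _)
  · refine Or.inr fun n => ?_
    have e1 : N₀ + 1 + n = (N₀ + n) + 1 := by ring
    rw [e1, hDv, hDv]
    exact hdown (N₀ + n) (Nat.le_add_right _ _)

/-! ### The composition: the three stubs imply the crux, BY NAME -/

/-- `BoundedResponseConverges` from the stubs (pure logic + real analysis; no `sorry`): STUB 1 (LANDED, used as a theorem) turns the
response sequence into the Kubo values (`D (N+1) = kuboValue N`); STUB 2 makes it eventually monotone (one of two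
directions); the crux's OWN hypothesis `BddAbove (range |D|)` then gives convergence (monotone convergence, both
branches — this is where `BddAbove` is consumed, as `_false_without_bddAbove_harmonic` demands); STUB 3 gives
`c ≤ D_N` eventually, hence `k ≥ c > 0`. -/
theorem BoundedResponseConverges_of (h2 : Registered.stub_kernelLadder)
    (h3 : JunctionLocality.ConductanceLowerBound) :
    OddSectorIrreversibility.BoundedResponseConverges := by
  intro ω₂ lam β γ hω hl hβ hγ hU μ hμ T hT D hD hB
  -- STUB 1 (CLOSED, p101517): the corner formula along this family, from the landed theorem
  have hDv : ∀ N : ℕ, D (N + 1) = kuboValue ω₂ lam β γ T N := fun N =>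
    (cornerKubo_holds ω₂ lam β γ hω hl hβ hγ hU μ hμ T hT N).2 (D (N + 1)) (hD (N + 1))
  -- STUB 2: the Kubo-value dichotomy
  obtain ⟨N₀, hlad⟩ := h2 ω₂ lam β γ hω hl hβ hγ T hT
  -- STUB 3: the floor
  obtain ⟨c, hc, N₁, hfloor⟩ := h3 ω₂ lam β γ hω hl hβ hγ hU μ hμ T hT D hD
  obtain ⟨B, hBB⟩ := hB
  have hB' : ∀ N, |D N| ≤ B := fun N => hBB ⟨N, rfl⟩
  exact tendsto_of_eventually_monotone_floor D (N₀ + 1) B c N₁ hc hB' hfloor (dichotomy_transport hDv hlad)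

/-- Wiring check: the registered stubs feed `BoundedResponseConverges_of` as stated. -/
example : OddSectorIrreversibility.BoundedResponseConverges :=
  BoundedResponseConverges_of stub_kernelLadder stub_floor

/- The three sibling routes' copies of the crux (`TransferKernelPositivity`, `LocalOhmBV`, `MatthiessenLadder`)
close by the very same term: they are definitional twins (`Disproof.*_twin_iff`, `Iff.rfl`); not imported here
to keep the check cone small. -/

/-! ### The predicted world: in the `↑` branch the floor is FREE (fixed-`N` positivity is landed) -/

/-- In the PREDICTED branch (`KernelLadderUp`) STUB 3 follows from STUB 1 and the LANDED fixed-`N` positivity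
`FeketeSeriesLaw.PositiveConductance` (stmt-11750, `TwoScaleGluingLogRigidity.Stubs.positiveConductance_holds`, p96209):
`c := D_{N₀+2} > 0` is a floor from there on. -/
theorem conductanceLowerBound_of_ladderUp (h2 : KernelLadderUp) :
    JunctionLocality.ConductanceLowerBound := by
  intro ω₂ lam β γ hω hl hβ hγ hU μ hμ T hT D hD
  have hDv : ∀ N : ℕ, D (N + 1) = kuboValue ω₂ lam β γ T N := fun N =>
    (cornerKubo_holds ω₂ lam β γ hω hl hβ hγ hU μ hμ T hT N).2 (D (N + 1)) (hD (N + 1))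
  obtain ⟨N₀, hup⟩ := h2 ω₂ lam β γ hω hl hβ hγ T hT
  have hmono : Monotone fun n : ℕ => D (N₀ + 1 + n) := by
    refine monotone_nat_of_le_succ fun n => ?_
    have e1 : N₀ + 1 + n = (N₀ + n) + 1 := by ring
    show D (N₀ + 1 + n) ≤ D (N₀ + 1 + n + 1)
    rw [e1, hDv, hDv]
    exact hup (N₀ + n) (Nat.le_add_right _ _)
  have hP := TwoScaleGluingLogRigidity.Stubs.positiveConductance_holds ω₂ lam β γ hω hl hβ hγ hU μ hμ T hT D hD
  refine ⟨D (N₀ + 1 + 1), hP (N₀ + 1 + 1) (by omega), N₀ + 1 + 1, fun N hN => ?_⟩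
  have h := hmono (show 1 ≤ N - (N₀ + 1) by omega)
  have e : N₀ + 1 + (N - (N₀ + 1)) = N := by omega
  simpa [e] using h

/-- ALTERNATIVE WIRING for the predicted world (PROVED; not the registered composition): the corner formula and
the `↑` ladder ALONE give both the floor (stmt-11749) and the crux (positivity being landed). Stated as a conjunction so
that the skeleton audit sees exactly one theorem concluding the crux. -/
theorem floor_and_crux_of_ladderUp (h2 : KernelLadderUp) :
    JunctionLocality.ConductanceLowerBound ∧ OddSectorIrreversibility.BoundedResponseConverges :=
  ⟨conductanceLowerBound_of_ladderUp h2,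
    BoundedResponseConverges_of (kernelLadder_of_up h2) (conductanceLowerBound_of_ladderUp h2)⟩

/-! ### Scratch checks against the landed Negative lemmas (`Theorems/BoundedResponseConverges/Negative/LoadBearing.lean`) -/

/-- `BddAbove` is load-bearing at the harmonic corner (landed): the ladder is TRUE there (`↑` branch, exact) and the
corner formula is an exact Gaussian identity, so the composition above MUST consume `hB` — it does, in
`tendsto_of_eventually_monotone_floor`. -/
example {ω₂ γ : ℝ} (hω : 0 < ω₂) (hγ : 0 < γ) :=
  Theorems.boundedResponseConverges_false_without_bddAbove_harmonic hω hγ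

/-- The insulating skeleton mode (landed) is what STUB 3 / positivity excludes; the oscillating mode (landed) is what
STUB 2 excludes. -/
example := Theorems.boundedResponseConverges_skeleton_insulating
example := Theorems.boundedResponseConverges_skeleton_oscillating

end Summit.AtomisticToContinuum.FouriersLaw.Cruxes.BoundedResponseConverges.OhmicFloorMonotoneLadder

end
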